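import Summits.Langlands.Langlands.Theses.AbelianSurfaceSerre
import Literature.NumberTheory.GaloisRepresentations.WeilDeligneGeneric
import Literature.NumberTheory.GaloisRepresentations.WeilDeligneOfGalois
import Literature.NumberTheory.Automorphic.HodgeInfinityType
import Literature.NumberTheory.Automorphic.CaraianiNewtonModularity
import Literature.NumberTheory.EllipticCurves.GaloisAction

/-!
# Sketch — crux ideas for `AbelianSurfaceSerre.SurfaceSectorComplement` (stmt-Langlands-17767)

Planner scratch (crux-ideate round 1, ideator 2).  First-lemma signatures of the three idea cards,
stated over existing declarations; nothing here is a route item.  `X` below is the route target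
`EndTrivialSurfacesModular` (the antecedent of the crux `SurfaceSectorComplement := X → Langlands`).

* §0  `EndTrivialSurfacesModularHodge` (X_hol): X with the archimedean clause
      `HasHodgeInfinityType 1 {0,0,1,1}`; `X_hol → X` proved.  (Transfer shared by all cards.)
* §1  card `motivic-purity-lgc`: `AbelianVarietyWDGeneric`, `EndTrivialSurfacesReciprocal`.
* §2  card `weil-restriction-window`: `QuadraticEllipticModular`, `ModPRealisableByEllipticCurves`.
* §3  card `mod3-weight-collapse`: `ModThreeResidualModularityGSp4`.
-/

open scoped NumberField Matrix
open NumberField IsDedekindDomain Field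
open Literature.NumberTheory.GaloisRepresentations Literature.NumberTheory.Automorphic
open Literature.AlgebraicGeometry.Motives (AbelianVariety)

noncomputable section

namespace Summit.Langlands.Langlands.Theses.AbelianSurfaceSerre.CruxIdeas

/-! ## §0 The archimedean repair X_hol (Transfer common to the three cards) -/

/-- **X_hol**: the route target `EndTrivialSurfacesModular` with the infinity type of `π` pinned to
the pure Hodge type of weight `1` and Hodge–Tate multiset `{0,0,1,1}` (the infinitesimal character of
the transfer to `GL₄` of a weight-`(2,2)` Siegel form; Buzzard–Gee Rem. 3.2.3 / 5.18, the clause the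
summit omits).  Zero-cost for tenure: BCGP's `π` has it. -/
def EndTrivialSurfacesModularHodge : Prop :=
  ∀ (A : AbelianVariety ℚ), A.dim = 2 →
    (∀ f : A ⟶ A, ∃ n : ℤ, f = n • CategoryTheory.CategoryStruct.id A) →
    ∀ (p : ℕ) [Fact p.Prime] (b : Module.Basis (Fin 4) ℚ_[p] (A.rationalTateModule p))
      (r : FramedGaloisRep ℚ (PadicAlgCl p) 4),
      (∀ g : absoluteGaloisGroup ℚ, (r g).val =
        ((LinearMap.toMatrix b b (A.rationalTateRep p g⁻¹)).map
          (algebraMap ℚ_[p] (PadicAlgCl p))).transpose) →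
      ∀ (hcpt : isCompact_glFiniteIntegralLevel 4 ℚ) (ι : PadicAlgCl p ≃+* ℂ),
        ∃ π : CuspidalAutomorphicRepData 4 ℚ hcpt,
          π.1.IsLAlgebraic ∧ π.1.HasHodgeInfinityType 1 {0, 0, 1, 1} ∧
          ∀ᶠ v : HeightOneSpectrum (𝓞 ℚ) in Filter.cofinite,
            Summit.Langlands.SatakeFrobCompatibleAt ι π.1 r v

/-- `X_hol → X`: the repaired target implies the filed one (drop the archimedean clause; the Satake
clause of `X` is literally `SatakeFrobCompatibleAt`). [folklore] -/
theorem endTrivialSurfacesModular_of_hodge (h : EndTrivialSurfacesModularHodge) :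
    EndTrivialSurfacesModular := by
  intro A hA hEnd p _ b r hr hcpt ι
  obtain ⟨π, hL, -, hS⟩ := h A hA hEnd p b r hr hcpt ι
  exact ⟨π, hL, hS⟩

/-! ## §1 Card `motivic-purity-lgc` -/

/-- **First lemma (motivic purity ⇒ genericity).**  For every abelian variety `A` over a number
field `K`, every `p`, every framing `r` of `(V_p A)^∨ ⊗ ℚ̄_p` and every finite `v ∤ p`, the
Weil–Deligne representation attached to `r|_{Γ_{K_v}}` by the Grothendieck–Deligne recipe is
GENERIC (Allen 2016 Def. 1.1.2).  Source chain: SGA7 IX (Grothendieck's monodromy theorem) + Weil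
(Deligne) ⇒ `WD_v(A)` is pure of weight `1` (weight–monodromy holds for abelian varieties) ⇒ pure ⇒
generic (Taylor–Yoshida 2007 Lemma 1.4; BCGP 2021 Lemma 2.5.1 and p. 105: "if `ρ_x` is pure then
`Hom(ρ_x, ρ_x(1)) = 0`"). -/
def AbelianVarietyWDGeneric : Prop :=
  ∀ (K : Type) [Field K] [NumberField K] (A : AbelianVariety K) (p : ℕ) [Fact p.Prime] (n : ℕ)
    (b : Module.Basis (Fin n) ℚ_[p] (A.rationalTateModule p))
    (r : FramedGaloisRep K (PadicAlgCl p) n),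
    (∀ g : absoluteGaloisGroup K, (r g).val =
      ((LinearMap.toMatrix b b (A.rationalTateRep p g⁻¹)).map
        (algebraMap ℚ_[p] (PadicAlgCl p))).transpose) →
    ∀ v : HeightOneSpectrum (𝓞 K), ((p : ℕ) : 𝓞 K) ∉ v.asIdeal →
      ∃ W : WeilDeligneRep (v.adicCompletion K) (PadicAlgCl p) (Fin n → PadicAlgCl p),
        IsWeilDeligneOfLadic (r.toLocal v).toWeilGroupHom W ∧ W.IsGeneric

/-- **Payoff of the line: the sector made fully reciprocal.**  X's pairs satisfy the summit's own
clause `Corresponds` (Satake a.e. AND local–global compatibility at EVERY finite place, `v ∣ p`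
included) for EVERY pinned reciprocity datum `𝓡`. -/
def EndTrivialSurfacesReciprocal : Prop :=
  ∀ (A : AbelianVariety ℚ), A.dim = 2 →
    (∀ f : A ⟶ A, ∃ n : ℤ, f = n • CategoryTheory.CategoryStruct.id A) →
    ∀ (p : ℕ) [Fact p.Prime] (b : Module.Basis (Fin 4) ℚ_[p] (A.rationalTateModule p))
      (r : FramedGaloisRep ℚ (PadicAlgCl p) 4),
      (∀ g : absoluteGaloisGroup ℚ, (r g).val =
        ((LinearMap.toMatrix b b (A.rationalTateRep p g⁻¹)).map
          (algebraMap ℚ_[p] (PadicAlgCl p))).transpose) →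
      ∀ (hcpt : isCompact_glFiniteIntegralLevel 4 ℚ) (ι : PadicAlgCl p ≃+* ℂ),
        ∃ π : CuspidalAutomorphicRepData 4 ℚ hcpt,
          π.1.IsLAlgebraic ∧ π.1.HasHodgeInfinityType 1 {0, 0, 1, 1} ∧
          ∀ 𝓡 : Summit.Langlands.ReciprocityData ℚ, Summit.Langlands.Corresponds 𝓡 ι π.1 r

/-- Sanity: the reciprocal sector implies X_hol (hence X): `Corresponds` contains the cofinite Satake
clause; a reciprocity datum exists by the summit's non-vacuity conjunct — here we just take one as a
hypothesis. [folklore] -/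
theorem hodge_of_reciprocal (h𝓡 : Nonempty (Summit.Langlands.ReciprocityData ℚ))
    (h : EndTrivialSurfacesReciprocal) : EndTrivialSurfacesModularHodge := by
  intro A hA hEnd p _ b r hr hcpt ι
  obtain ⟨π, hL, hT, hC⟩ := h A hA hEnd p b r hr hcpt ι
  obtain ⟨𝓡⟩ := h𝓡
  exact ⟨π, hL, hT, (hC 𝓡).1⟩

/-! ## §2 Card `weil-restriction-window` -/

/-- **Payoff of the soft half: every elliptic curve over every quadratic field is modular** (the
Caraiani–Newton notion `IsModularEllipticCurve`: CM, or a weight-zero cuspidal `π` on `GL₂(𝔸_F)`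
with `q_w^{1/2} e₁(α_w) = a_w(E)` a.e.).  Removes the hypothesis "`X₀(15)(F)` finite" of
`CaraianiNewton2023_modularity` and covers real quadratic `F` (FLS 2015) uniformly. -/
def QuadraticEllipticModular : Prop :=
  ∀ (F : Type) [Field F] [NumberField F], Module.finrank ℚ F = 2 →
    ∀ E : WeierstrassCurve (𝓞 F), E.Δ ≠ 0 → IsModularEllipticCurve F E

/-- **First lemma of the hard half (genus-0 level structures): realisability of mod-`p`
representations by elliptic curves, `p ∈ {2, 3, 5}`.**  Over any number field `F`, every continuous
`ρ̄ : Γ_F → GL₂(𝔽_p)` with `det ρ̄ = ε̄_p` is `E[p]` for an elliptic curve `E/F` (the twist `X(ρ̄)`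
of the genus-0 curve `X(p)` is a Brauer–Severi curve split by Tate's lifting theorem + Hilbert 90;
Shepherd-Barron–Taylor 1997 for `p = 2, 5`, Rubin 1997 / folklore for `p = 3`).  Rendered through
the tree's `galoisRepTorsion` (the `Γ_F`-action on `E[p](F̄)`): there are a Weierstrass model `E`
and an additive isomorphism `E[p](F̄) ≃ 𝔽_p²` intertwining the Galois action with `ρ̄`. -/
def ModPRealisableByEllipticCurves (p : ℕ) [Fact p.Prime] : Prop :=
  ∀ (F : Type) [Field F] [NumberField F] (ρ : FramedGaloisRep F (ZMod p) 2),
    (∀ g : absoluteGaloisGroup F,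
      (ρ g).val.det = ((modPCyclotomicCharacterZMod F p g : (ZMod p)ˣ) : ZMod p)) →
    ∃ (E : WeierstrassCurve F) (_ : E.IsElliptic)
      (e : WeierstrassCurve.geomTorsion E p ≃+ (Fin 2 → ZMod p)),
      ∀ (g : absoluteGaloisGroup F) (P : WeierstrassCurve.geomTorsion E p),
        e (g • P) = (ρ g).val.mulVec (e P)

/-! ## §3 Card `mod3-weight-collapse` -/

/-- **First lemma: image-blind, condition-free residual modularity mod `3` for `GSp₄/ℚ` (weight
`2`).**  Every continuous `ρ̄ : Γ_ℚ → GL₄(𝔽₃)` preserving a non-degenerate alternating form up to the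
multiplier `ε̄₃⁻¹` is the reduction of the `3`-adic partner `r` of an X_hol pair `(π, r)`: `π`
L-algebraic cuspidal on `GL₄(𝔸_ℚ)` of Hodge infinity type `(1; {0,0,1,1})`, Satake–Frobenius
compatible with `r` a.e., with `charpoly r(g) ∈ ℤ̄₃[X]` reducing to `charpoly ρ̄(g)` for all `g`.
Intended proof: BCGP 2021 Thm. 10.2.x / 2025 Def. 9.2.1 (`P(ρ̄)` unirational over `ℚ`: `ρ̄ ≅ A[3]^∨`
for infinitely many abelian surfaces `A/ℚ`, `End(A_ℚ̄) = ℤ` by thin-set avoidance) + X_hol applied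
to `A`.  NO hypothesis at `2`, at `3`, or on the image (contrast the route's anchor fact
`bcgp_switch_exists_modular_abelianSurface`: ordinary finite flat at `3`, unramified at `2` off
`4C/12C`). -/
def ModThreeResidualModularityGSp4 : Prop :=
  ∀ ρ : FramedGaloisRep ℚ (ZMod 3) 4,
    (∃ J : Matrix (Fin 4) (Fin 4) (ZMod 3), J.transpose = -J ∧ IsUnit J.det ∧
      ∀ g : absoluteGaloisGroup ℚ, (ρ g).val.transpose * J * (ρ g).val =
        (((modPCyclotomicCharacterZMod ℚ 3 g)⁻¹ : (ZMod 3)ˣ) : ZMod 3) • J) →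
    ∀ (hcpt : isCompact_glFiniteIntegralLevel 4 ℚ) (ι : PadicAlgCl 3 ≃+* ℂ),
      ∃ (π : CuspidalAutomorphicRepData 4 ℚ hcpt) (r : FramedGaloisRep ℚ (PadicAlgCl 3) 4),
        π.1.IsLAlgebraic ∧ π.1.HasHodgeInfinityType 1 {0, 0, 1, 1} ∧
        (∀ᶠ v : HeightOneSpectrum (𝓞 ℚ) in Filter.cofinite,
          Summit.Langlands.SatakeFrobCompatibleAt ι π.1 r v) ∧
        ∃ red : (Valued.v : Valuation (PadicAlgCl 3) NNReal).valuationSubring →+*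
            AlgebraicClosure (ZMod 3),
          ∀ g : absoluteGaloisGroup ℚ,
            ∃ P : Polynomial (Valued.v : Valuation (PadicAlgCl 3) NNReal).valuationSubring,
              P.map (Valued.v : Valuation (PadicAlgCl 3) NNReal).valuationSubring.subtype =
                FramedRep.charpoly r g ∧
              P.map red = (FramedRep.charpoly ρ g).map (algebraMap (ZMod 3) (AlgebraicClosure (ZMod 3)))

end Summit.Langlands.Langlands.Theses.AbelianSurfaceSerre.CruxIdeas

end
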